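import Summits.QuantumFields.YangMills.Theorems.WeakCouplingRatesDirichletVsFree
import Summits.QuantumFields.YangMills.Theorems.WeakCouplingRatesColdBoxPlaqVariance
import Summits.QuantumFields.YangMills.Theorems.WeakCouplingRatesBulkDominatesColdBoxWDefs

/-!
# Crux `BulkDominatesColdBoxW` (stmt-QuantumFields-19609), stub L1a `stub_goodBoundaryCovStable`: interface N1 `DirKernelTwoPoint` —
# the temporal-gauge Dirichlet curvature kernel at depth `T = ⌈β^A⌉ ≪ H = ⌈β^θ⌉` is of Coulomb size, `1/(4π²T⁴) ≤ C_D(p_c, p_c+Te₀) ≤ 1`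

The lead's census v3 (item evidence #12) splits L1a into `KernelCovExpansion ∧ FlatCovExpansion ∧ DirKernelTwoPoint`
(`Theorems/WeakCouplingRatesBulkDominatesColdBoxWDefs.lean`, reduction `…CovStableOfExpansion.lean`); this file PROVES the third BY NAME for all
exponents `0 < A < θ`:

* `boxDirProjKernel_centre_eq` — the kernel of the interface is `boxDirichletPlaqCov H T` (definitional, `boxDirichletPlaqCov_eq_dotProduct`);
* `boxDirProjKernel_le_one_of_mem` — **upper bound** `C_D(p,q) ≤ 1` for any two plaquette labels of the enlarged box
  (`E[X_pX_q] ≤ ½(E X_p² + E X_q²) ≤ 1`, `integral_dirCirc_sq_le_one`);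
* `boxDirichletPlaqCov_ge` — **lower bound** `1/(4π²T⁴) ≤ Π^D_H(T)` as soon as `H ≥ 32`, `(1 + 40π²K)·T ≤ H/8` and `T ≥ 2π²K_C + 1`
  (★19608-p2's `exists_boxDirichletPlaqCov_sub_bound` `|Π^D_H(T) − C(T)| ≤ K/H⁴` + `exists_curvaturePlaquetteCorr_asymp` `C(T) = T⁻⁴/π² + O(T⁻⁵)`;
  the arithmetic of `stub_boxKernelDirichletVsFree`);
* `dirKernelTwoPoint : 0 < A → A < θ → DirKernelTwoPoint A θ` — the typed interface, closed (`κ′ = 1/(4π²)`).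

Fleet seat `ym-spine-20043-p1` (g3, re-targeted to R2ξ by director-ym LINE №76/№78; line lead `ym-wcr-19609-p1`).  No sorry, standard axioms,
no new definition, no named-fact hypothesis.  NOT a claim about the mass gap: a statement about a finite-dimensional Gaussian kernel.
-/

set_option autoImplicit false

noncomputable section

open MeasureTheory Finset Matrix Real
open Literature.Probability.LatticeModels
open Literature.MathematicalPhysics.QuantumLattice
open Literature.MathematicalPhysics.QuantumFieldTheory
open Literature.MathematicalPhysics.QuantumFieldTheory.LatticeMaxwell
open Literature.MathematicalPhysics.QuantumFieldTheory.AxialGauge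

namespace Summit.QuantumFields.YangMills.Theorems.WeakCouplingRates

/-- The kernel of the interface is the Dirichlet plaquette kernel D1' of `Theorems/WeakCouplingRatesDefs.lean` (definitional). -/
theorem boxDirProjKernel_centre_eq (H T : ℕ) :
    boxDirProjKernel H (boxCentre H, 1, 2) (boxCentre H + Pi.single 0 (T : ℤ), 1, 2) = boxDirichletPlaqCov H T :=
  (boxDirichletPlaqCov_eq_dotProduct H T).symm

/-- **Upper bound**: the Dirichlet kernel between two plaquette labels of the enlarged box is at most `1`
(`2E[X_pX_q] ≤ E X_p² + E X_q² ≤ 2`). -/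
theorem boxDirProjKernel_le_one_of_mem {H : ℕ} {p q : Plaq 4}
    (hp : p ∈ plaquettesIn (halfOpenBox 4 (2 * H + 3))) (hq : q ∈ plaquettesIn (halfOpenBox 4 (2 * H + 3))) :
    boxDirProjKernel H (Plaq.shift dirCorner p) (Plaq.shift dirCorner q) ≤ 1 := by
  have hpq : boxDirProjKernel H (Plaq.shift dirCorner p) (Plaq.shift dirCorner q) =
      ∫ s, dirCirc H (Plaq.shift dirCorner p) s * dirCirc H (Plaq.shift dirCorner q) s ∂(boxDirichlet H) :=
    (integral_dirCirc_mul _ _).symm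
  have h1 := integral_dirCirc_sq_le_one (H := H) p hp
  have h2 := integral_dirCirc_sq_le_one (H := H) q hq
  have hi1 : Integrable (fun s => dirCirc H (Plaq.shift dirCorner p) s ^ 2) (boxDirichlet H) :=
    ((isGaussianProcess_dirCirc H).hasGaussianLaw_eval _).memLp_two.integrable_sq
  have hi2 : Integrable (fun s => dirCirc H (Plaq.shift dirCorner q) s ^ 2) (boxDirichlet H) :=
    ((isGaussianProcess_dirCirc H).hasGaussianLaw_eval _).memLp_two.integrable_sq
  have hprod : Integrable (fun s => dirCirc H (Plaq.shift dirCorner p) s * dirCirc H (Plaq.shift dirCorner q) s) (boxDirichlet H) :=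
    ((isGaussianProcess_dirCirc H).hasGaussianLaw_eval _).memLp_two.integrable_mul
      ((isGaussianProcess_dirCirc H).hasGaussianLaw_eval _).memLp_two
  have hle : ∫ s, dirCirc H (Plaq.shift dirCorner p) s * dirCirc H (Plaq.shift dirCorner q) s ∂(boxDirichlet H) ≤
      ∫ s, (dirCirc H (Plaq.shift dirCorner p) s ^ 2 + dirCirc H (Plaq.shift dirCorner q) s ^ 2) / 2 ∂(boxDirichlet H) := by
    refine integral_mono hprod ((hi1.add hi2).div_const 2) fun s => ?_
    have := sq_nonneg (dirCirc H (Plaq.shift dirCorner p) s - dirCirc H (Plaq.shift dirCorner q) s)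
    simp only
    nlinarith
  rw [integral_div, integral_add hi1 hi2] at hle
  rw [hpq]
  linarith

/-- **Lower bound**: `1/(4π²T⁴) ≤ Π^D_H(T)` whenever `H ≥ 32`, `(1 + 40π²K)·T ≤ H/8` and `2π²K_C + 1 ≤ T`, where `K`, `K_C` are the
constants of `exists_boxDirichletPlaqCov_sub_bound` and `exists_curvaturePlaquetteCorr_asymp`. -/
theorem boxDirichletPlaqCov_ge : ∃ M L : ℝ, 1 ≤ M ∧ 1 ≤ L ∧ ∀ (H : ℕ), (32 : ℝ) ≤ H → ∀ (T : ℕ),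
    M * (T : ℝ) ≤ (H : ℝ) / 8 → L ≤ (T : ℝ) → 1 / (4 * π ^ 2) / (T : ℝ) ^ 4 ≤ boxDirichletPlaqCov H T := by
  obtain ⟨K₂, hK20, hE2⟩ := exists_boxDirichletPlaqCov_sub_bound
  obtain ⟨K_C, hKC0, hC⟩ := exists_curvaturePlaquetteCorr_asymp
  set M : ℝ := 1 + 40 * π ^ 2 * K₂ with hM
  have hM0 : 0 ≤ 40 * π ^ 2 * K₂ := by positivity
  have hM1 : 1 ≤ M := by linarith
  set L : ℝ := 2 * π ^ 2 * K_C + 1 with hL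
  have hL0 : 0 ≤ 2 * π ^ 2 * K_C := by positivity
  have hL1 : 1 ≤ L := by linarith
  refine ⟨M, L, hM1, hL1, fun H hH32 T hHT hLT => ?_⟩
  have hH0 : (0 : ℝ) < H := by linarith
  have hT1r : (1 : ℝ) ≤ T := hL1.trans hLT
  have hT1 : 1 ≤ T := by exact_mod_cast hT1r
  have hT0 : (0 : ℝ) < T := by linarith
  have hTH : (T : ℝ) ≤ (H : ℝ) / 8 := by
    have : (T : ℝ) ≤ M * T := le_mul_of_one_le_left hT0.le hM1
    linarith
  set C := @Literature.MathematicalPhysics.QuantumFieldTheory.curvaturePlaquetteCorr 4 (by norm_num) (T : ℤ) with hCdef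
  have hasy := hC T hT1
  have hCT : K_C / (T : ℝ) ^ 5 ≤ (1 / π ^ 2 / (T : ℝ) ^ 4) / 2 := by
    have hKT : 2 * π ^ 2 * K_C ≤ (T : ℝ) := by linarith
    have e : (1 / π ^ 2 / (T : ℝ) ^ 4) / 2 = 1 / (2 * π ^ 2) / (T : ℝ) ^ 4 := by field_simp
    rw [e, div_le_div_iff₀ (by positivity) (by positivity)]
    calc K_C * (T : ℝ) ^ 4 = (2 * π ^ 2 * K_C) * (T : ℝ) ^ 4 * (1 / (2 * π ^ 2)) := by field_simp
      _ ≤ (T : ℝ) * (T : ℝ) ^ 4 * (1 / (2 * π ^ 2)) := by gcongr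
      _ = 1 / (2 * π ^ 2) * (T : ℝ) ^ 5 := by ring
  have hClow : (1 / π ^ 2 / (T : ℝ) ^ 4) / 2 ≤ C := by
    rw [abs_le] at hasy; linarith [hasy.1]
  have hC0 : 0 ≤ C := le_trans (by positivity) hClow
  -- the kernel error is `≤ C/20`
  have herr : K₂ / (H : ℝ) ^ 4 ≤ C / 20 := by
    have hMT : M * (T : ℝ) ≤ H := by linarith
    have hMT4 : (M * (T : ℝ)) ^ 4 ≤ (H : ℝ) ^ 4 := pow_le_pow_left₀ (by positivity) hMT 4
    have hM4 : 40 * π ^ 2 * K₂ ≤ M ^ 4 := by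
      have : M ≤ M ^ 4 := by
        calc M = M ^ 1 := (pow_one M).symm
          _ ≤ M ^ 4 := pow_le_pow_right₀ hM1 (by norm_num)
      nlinarith [Real.pi_pos]
    have hstep : K₂ / (H : ℝ) ^ 4 ≤ 1 / (40 * π ^ 2) / (T : ℝ) ^ 4 := by
      rw [div_le_div_iff₀ (by positivity) (by positivity)]
      calc K₂ * (T : ℝ) ^ 4 = (40 * π ^ 2 * K₂) * (T : ℝ) ^ 4 * (1 / (40 * π ^ 2)) := by field_simp
        _ ≤ M ^ 4 * (T : ℝ) ^ 4 * (1 / (40 * π ^ 2)) := by gcongr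
        _ = 1 / (40 * π ^ 2) * (M * (T : ℝ)) ^ 4 := by ring
        _ ≤ 1 / (40 * π ^ 2) * (H : ℝ) ^ 4 := mul_le_mul_of_nonneg_left hMT4 (by positivity)
    have e : 1 / (40 * π ^ 2) / (T : ℝ) ^ 4 = ((1 / π ^ 2 / (T : ℝ) ^ 4) / 2) / 20 := by field_simp; ring
    rw [e] at hstep
    exact hstep.trans (by linarith)
  have h2 := (hE2 H hH32 T hTH).trans herr
  rw [abs_le] at h2
  have hlow : C - C / 20 ≤ boxDirichletPlaqCov H T := by linarith [h2.1]
  have e4 : 1 / (4 * π ^ 2) / (T : ℝ) ^ 4 = ((1 / π ^ 2 / (T : ℝ) ^ 4) / 2) / 2 := by field_simp; ring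
  rw [e4]
  nlinarith

/-- **Interface N1 of stub L1a, CLOSED: `DirKernelTwoPoint A θ` for all exponents `0 < A < θ`** — eventually in `β`,
`1/(4π²⌈β^A⌉⁴) ≤ C_D(p_c, p_c + ⌈β^A⌉e₀) ≤ 1` for the temporal-gauge Dirichlet kernel of the cold box of side `2⌈β^θ⌉ + 1`. -/
theorem dirKernelTwoPoint {A θ : ℝ} (hA : 0 < A) (hAθ : A < θ) : DirKernelTwoPoint A θ := by
  obtain ⟨M, L, hM1, hL1, hlow⟩ := boxDirichletPlaqCov_ge
  have hθ : 0 < θ := hA.trans hAθ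
  have hθA : 0 < θ - A := by linarith
  refine ⟨1 / (4 * π ^ 2), by positivity,
    max (max 1 ((32 : ℝ) ^ (1 / θ))) (max ((16 * M) ^ (1 / (θ - A))) (L ^ (1 / A))), fun β hβ => ?_⟩
  have hβ1 : 1 ≤ β := le_trans (le_trans (le_max_left _ _) (le_max_left _ _)) hβ
  have hθpow : (32 : ℝ) ≤ β ^ θ :=
    le_rpow_of_root_le (by norm_num) hθ (le_trans (le_trans (le_max_right _ _) (le_max_left _ _)) hβ)
  have hdiff : 16 * M ≤ β ^ (θ - A) :=
    le_rpow_of_root_le (by positivity) hθA (le_trans (le_trans (le_max_left _ _) (le_max_right _ _)) hβ)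
  have hApow : L ≤ β ^ A :=
    le_rpow_of_root_le (by positivity) hA (le_trans (le_trans (le_max_right _ _) (le_max_right _ _)) hβ)
  have hA1 : 1 ≤ β ^ A := hL1.trans hApow
  have hsplit : β ^ θ = β ^ (θ - A) * β ^ A := by
    rw [← Real.rpow_add (by linarith)]; ring_nf
  set T : ℕ := ⌈β ^ A⌉₊ with hT
  set H : ℕ := ⌈β ^ θ⌉₊ with hH
  have hT_ge : β ^ A ≤ (T : ℝ) := Nat.le_ceil _
  have hT_lt : (T : ℝ) < β ^ A + 1 := Nat.ceil_lt_add_one (by positivity)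
  have hT_le : (T : ℝ) ≤ 2 * β ^ A := by linarith
  have hH_ge : β ^ θ ≤ (H : ℝ) := Nat.le_ceil _
  have hH32 : (32 : ℝ) ≤ H := hθpow.trans hH_ge
  have hHT : M * (T : ℝ) ≤ (H : ℝ) / 8 := by
    have h1 : M * (T : ℝ) ≤ M * (2 * β ^ A) := mul_le_mul_of_nonneg_left hT_le (by linarith)
    have h2 : 16 * M * β ^ A ≤ β ^ (θ - A) * β ^ A := mul_le_mul_of_nonneg_right hdiff (by linarith)
    rw [← hsplit] at h2
    linarith
  have hLT : L ≤ (T : ℝ) := hApow.trans hT_ge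
  have hTH1 : T ≤ H + 1 := by
    have hT0 : (0 : ℝ) ≤ T := Nat.cast_nonneg T
    have : (T : ℝ) ≤ M * T := le_mul_of_one_le_left hT0 hM1
    have : (T : ℝ) ≤ H + 1 := by linarith
    exact_mod_cast this
  refine ⟨?_, ?_⟩
  · rw [boxDirProjKernel_centre_eq]
    exact hlow H hH32 T hHT hLT
  · obtain ⟨hp, hq, hps, hqs⟩ := centre_labels_mem (H := H) hTH1
    have h := boxDirProjKernel_le_one_of_mem hp hq
    rw [hps, hqs] at h
    exact h

end Summit.QuantumFields.YangMills.Theorems.WeakCouplingRates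

end
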